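import Summits.QuantumFields.YangMills.Theorems.IR.ShellMaxCorrHeatBath
import Summits.QuantumFields.YangMills.Theorems.IR.CollarDecouplingNest

/-!
# Crux `IR` (item stmt-QuantumFields-19354) — line «maximal correlation at one physical thickness»:
DOBRUSHIN'S CONDITION ⇒ A DIMENSION-FREE POINCARÉ INEQUALITY FOR THE SINGLE-SITE HEAT BATH

Helper module for item `stmt-QuantumFields-19354` (`--supports … --as helper`; it closes nothing; lead prover
ym-ir-line-mxc-p1, g2).  First input of the g2 route to the registered stub `ShellMaxCorr.stub_shellRung : ShellRung`
(strong-coupling rung of the shell maximal-correlation format, `Theorems/IR/ShellMaxCorrDefs.lean`): the missing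
`R`-uniform maximal-correlation bound is obtained in `L²` from (P) a Poincaré inequality for the single-site heat bath
whose constant does not depend on the number of sites, and (B) a Bessel/Schur bound for the boundary influences
(`Theorems/IR/ShellMaxCorrBessel.lean`).  This file is (P), for a GENERAL specification `γ` on `V → S` (`V` finite)
satisfying Dobrushin's condition in the Vasserstein form of the tree (`DobrushinMetric.IsKRContraction γ r nbr C`,
row sums `∑_y C x y ≤ α`) and a Gibbs measure `μ`:

  `(1 − α) · ∫ (f − μ f)² dμ ≤ ∑_{x ∈ V} ∫ (f − T_x f)² dμ`        (`poincare_of_isKRContraction`)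

for every bounded measurable `f` with a coordinatewise `r`-Lipschitz bound (every bounded `f` when `r ≡ 1`,
`poincare_of_isKRContraction_one`), where `T_x f (η) = ∫ f dγ_{x}(·|η)` is the single-site averaging operator
(`DobrushinMetric.siteAvg`) and `∫ (f − T_x f)² dμ = μ(Var(f | 𝓕_{≠x}))` is the heat-bath Dirichlet form at `x`.
The statement (spectral gap `≥ 1 − α` of the Gibbs sampler under Dobrushin's condition) is L. Wu, *Poincaré and
transportation inequalities for Gibbs measures under the Dobrushin uniqueness condition*, Ann. Probab. 34 (2006)
1960–1989; the proof given here is the elementary `L²` route (Aizenman–Holley 1987 style): (i) the random-scan operator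
`P = (1/n) ∑_x T_x` contracts the `ℓ¹`-norm of the Lipschitz vector by `θ = 1 − (1−α)/n`
(`HeatBath.exists_isLipBound_scan_iterate`), so `a_k = ⟨P^k f₀, f₀⟩_μ ≤ K θ^k` for the centred `f₀`; (ii) `P` is a
self-adjoint average of the projections `T_x` in `L²(μ)`, so `a_j² ≤ a_0 a_{2j}` and hence
`a_1^{2^m} ≤ a_0^{2^m−1} a_{2^m}` (`le_mul_of_sq_chain`); (iii) therefore `a_1 ≤ θ a_0`, i.e.
`∑_x ‖f₀ − T_x f₀‖² = n(a_0 − a_1) ≥ (1−α)‖f₀‖²`.  (`α < 1` is where the inequality has content; it is not needed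
for its truth.)

HONEST FRAMING: abstract probability (finite-range Gibbs specifications at high temperature); nothing here is specific
to Yang–Mills, and nothing here proves `ShellRung`, the loads, or any mass gap.

Refs: L. Wu, Ann. Probab. 34 (2006) 1960–1989; M. Aizenman, R. Holley, IMA Vol. Math. Appl. 8 (1987) 1–11;
H. Föllmer, LNM 1362 (1988) Ch. I Lemma (2.5); M. Dyer, L. A. Goldberg, M. Jerrum, Combin. Probab. Comput. 17 (2008)
761–779 (Dobrushin conditions and systematic scan).
-/

set_option autoImplicit false

noncomputable section

open MeasureTheory ProbabilityTheory Finset Function Filter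
open Literature.Probability.LatticeModels Literature.Probability.LatticeModels.DobrushinMetric
open Summit.QuantumFields.YangMills.Cruxes.IR.CollarDecoupling (sq_integral_mul_le)

namespace Summit.QuantumFields.YangMills.Cruxes.IR.ShellMaxCorr.HeatBath

/-! ## §3 The Poincaré inequality -/

section Poincare

/-- **Real-variable lemma.**  If `a_j² ≤ a_0 a_{2j}` for all `j` (a symmetric contraction: `a_j = ⟨P^j f, f⟩`) and
`a_k ≤ K θ^k` for all `k` (`θ ≥ 0`), then `a_1 ≤ θ a_0`.  (By induction `a_1^{2^m} ≤ a_0^{2^m − 1} a_{2^m} ≤ a_0^{2^m−1} K θ^{2^m}`,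
and `(a_1/θ a_0)^{2^m}` would be unbounded if `a_1 > θ a_0`; Bernoulli's inequality suffices.) -/
theorem le_mul_of_sq_chain {a : ℕ → ℝ} {θ K : ℝ} (hθ : 0 ≤ θ) (ha0 : 0 ≤ a 0)
    (hcs : ∀ j, a j ^ 2 ≤ a 0 * a (2 * j)) (hdecay : ∀ k, a k ≤ K * θ ^ k) : a 1 ≤ θ * a 0 := by
  rcases hθ.eq_or_lt with hθ0 | hθpos
  · -- `θ = 0`: `a 1 ≤ K · 0 = 0`
    have h := hdecay 1
    rw [← hθ0] at h ⊢
    simpa using h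
  -- the chain `a_1^N ≤ a_0^(N - 1) a_N` for `N = 2^(m+1)`
  have hchain : ∀ m : ℕ, a 1 ^ 2 ^ (m + 1) ≤ a 0 ^ (2 ^ (m + 1) - 1) * a (2 ^ (m + 1)) := by
    intro m
    induction m with
    | zero => simpa using hcs 1
    | succ m ih =>
      set N : ℕ := 2 ^ (m + 1) with hN
      have hN1 : 1 ≤ N := Nat.one_le_two_pow
      have hN2 : 2 ^ (m + 2) = 2 * N := by rw [hN, pow_succ]; ring
      have hev : Even N := by rw [hN]; exact Nat.even_pow.2 ⟨even_two, Nat.succ_ne_zero m⟩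
      have hpos : 0 ≤ a 1 ^ N := hev.pow_nonneg _
      have h3 : a N ^ 2 ≤ a 0 * a (2 * N) := hcs N
      have h4 : 0 ≤ a 0 ^ (2 * N - 2) := pow_nonneg ha0 _
      rw [hN2]
      calc a 1 ^ (2 * N) = (a 1 ^ N) ^ 2 := by rw [← pow_mul, mul_comm]
        _ ≤ (a 0 ^ (N - 1) * a N) ^ 2 := pow_le_pow_left₀ hpos ih 2
        _ = a 0 ^ (2 * N - 2) * a N ^ 2 := by
            rw [mul_pow, ← pow_mul]
            congr 2
            omega
        _ ≤ a 0 ^ (2 * N - 2) * (a 0 * a (2 * N)) := mul_le_mul_of_nonneg_left h3 h4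
        _ = a 0 ^ (2 * N - 1) * a (2 * N) := by
            have he : 2 * N - 1 = (2 * N - 2) + 1 := by omega
            rw [he, pow_succ]; ring
  -- combine with the decay
  have hbound : ∀ m : ℕ, a 1 ^ 2 ^ (m + 1) ≤ a 0 ^ (2 ^ (m + 1) - 1) * (K * θ ^ 2 ^ (m + 1)) := fun m =>
    (hchain m).trans (mul_le_mul_of_nonneg_left (hdecay _) (pow_nonneg ha0 _))
  by_contra hlt
  rw [not_le] at hlt
  rcases ha0.eq_or_lt with ha0zero | ha0pos
  · -- `a 0 = 0`: then `a 1² ≤ 0`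
    have h := hcs 1
    rw [← ha0zero, zero_mul] at h
    have h1 : a 1 = 0 := pow_eq_zero_iff (n := 2) (by norm_num) |>.1 (le_antisymm h (sq_nonneg _))
    rw [h1, ← ha0zero, mul_zero] at hlt
    exact lt_irrefl _ hlt
  -- `a 0 > 0`: the ratio `q = a 1 / (θ a 0) > 1` has unbounded powers
  set q : ℝ := a 1 / (θ * a 0) with hq
  have hθa : 0 < θ * a 0 := mul_pos hθpos ha0pos
  have hq1 : 1 < q := by rw [hq, one_lt_div hθa]; exact hlt
  have ha1eq : a 1 = q * θ * a 0 := by rw [hq]; field_simp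
  have hqpow : ∀ m : ℕ, q ^ 2 ^ (m + 1) * a 0 ≤ K := by
    intro m
    set N : ℕ := 2 ^ (m + 1) with hN
    have hN1 : 1 ≤ N := Nat.one_le_two_pow
    have h := hbound m
    rw [← hN, ha1eq, mul_pow, mul_pow] at h
    have ha0N : a 0 ^ N = a 0 ^ (N - 1) * a 0 := by rw [← pow_succ, Nat.sub_add_cancel hN1]
    rw [ha0N] at h
    have hpos : 0 < θ ^ N * a 0 ^ (N - 1) := mul_pos (pow_pos hθpos _) (pow_pos ha0pos _)
    have h' : (q ^ N * a 0) * (θ ^ N * a 0 ^ (N - 1)) ≤ K * (θ ^ N * a 0 ^ (N - 1)) := by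
      calc (q ^ N * a 0) * (θ ^ N * a 0 ^ (N - 1))
          = q ^ N * θ ^ N * (a 0 ^ (N - 1) * a 0) := by ring
        _ ≤ a 0 ^ (N - 1) * (K * θ ^ N) := h
        _ = K * (θ ^ N * a 0 ^ (N - 1)) := by ring
    exact le_of_mul_le_mul_right h' hpos
  -- Bernoulli: `q^N ≥ 1 + N (q - 1)`, and `N = 2^(m+1) ≥ m + 1` is unbounded
  obtain ⟨m, hm⟩ := exists_nat_gt (K / (a 0 * (q - 1)))
  have hq0 : 0 < q - 1 := by linarith
  have hbern : 1 + ((2 ^ (m + 1) : ℕ) : ℝ) * (q - 1) ≤ q ^ 2 ^ (m + 1) := by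
    have := one_add_mul_le_pow (by linarith : (-2 : ℝ) ≤ q - 1) (2 ^ (m + 1))
    simpa using this
  have hN : (m : ℝ) + 1 ≤ ((2 ^ (m + 1) : ℕ) : ℝ) := by
    have : m + 1 < 2 ^ (m + 1) := Nat.lt_two_pow_self
    exact_mod_cast this.le
  have hcontra : K < q ^ 2 ^ (m + 1) * a 0 := by
    have h1 : K < (m + 1) * (q - 1) * a 0 := by
      have hm' : K / (a 0 * (q - 1)) < (m : ℝ) + 1 := hm.trans (by linarith)
      rw [div_lt_iff₀ (mul_pos ha0pos hq0)] at hm'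
      linarith
    have h2 : ((m : ℝ) + 1) * (q - 1) * a 0 ≤ q ^ 2 ^ (m + 1) * a 0 := by
      refine mul_le_mul_of_nonneg_right ?_ ha0pos.le
      calc ((m : ℝ) + 1) * (q - 1) ≤ ((2 ^ (m + 1) : ℕ) : ℝ) * (q - 1) :=
            mul_le_mul_of_nonneg_right hN hq0.le
        _ ≤ 1 + ((2 ^ (m + 1) : ℕ) : ℝ) * (q - 1) := by linarith
        _ ≤ q ^ 2 ^ (m + 1) := hbern
    exact h1.trans_le h2
  exact absurd (hqpow m) (not_le.2 hcontra)

variable {V S : Type*} [MeasurableSpace S] {γ : Specification V S}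
  {r : S → S → ℝ} {nbr : V → Finset V} {C : V → V → ℝ} [Fintype V] [DecidableEq V] {μ : Measure (V → S)}

/-- **Dobrushin's condition ⇒ Poincaré inequality for the single-site heat bath, dimension-free** (Wu 2006):
if the one-site kernels of `γ` satisfy Dobrushin's condition in the Vasserstein form for a weight `0 ≤ r ≤ R` with row
sums `∑_y C x y ≤ α`, then for every Gibbs measure `μ` and every bounded measurable `f` with a coordinatewise
`r`-Lipschitz bound, `(1 − α) ∫ (f − μ f)² dμ ≤ ∑_x ∫ (f − T_x f)² dμ` (content for `α < 1`; vacuous otherwise). -/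
theorem poincare_of_isKRContraction [Nonempty V] (hγ : IsSpecification γ) (hC : IsKRContraction γ r nbr C)
    {R : ℝ} (hrR : ∀ a b, r a b ≤ R) (hR : 0 ≤ R) {α : ℝ}
    (hrow : ∀ x, ∑ y ∈ nbr x, C x y ≤ α) (hμ : IsGibbsMeasure γ μ) {f : (V → S) → ℝ}
    (hfm : Measurable f) {M : ℝ} (hM : ∀ σ, |f σ| ≤ M) {δ : V → ℝ} (hδ : IsLipBound r f δ) :
    (1 - α) * ∫ σ, (f σ - ∫ τ, f τ ∂μ) ^ 2 ∂μ ≤ ∑ x, ∫ σ, (f σ - siteAvg γ x f σ) ^ 2 ∂μ := by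
  haveI := hμ.isProbabilityMeasure
  have hn : (0 : ℝ) < Fintype.card V := by exact_mod_cast Fintype.card_pos
  -- the centred observable
  set c : ℝ := ∫ τ, f τ ∂μ with hc
  set f₀ : (V → S) → ℝ := fun σ => f σ - c with hf₀
  have hf₀m : Measurable f₀ := hfm.sub_const c
  have hcM : |c| ≤ M := by
    have h := norm_integral_le_of_norm_le_const (μ := μ) (f := f) (C := M)
      (ae_of_all _ fun σ => by rw [Real.norm_eq_abs]; exact hM σ)
    simpa [hc] using h
  have hf₀M : ∀ σ, |f₀ σ| ≤ 2 * M := fun σ => by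
    calc |f σ - c| ≤ |f σ| + |c| := abs_sub _ _
      _ ≤ M + M := add_le_add (hM σ) hcM
      _ = 2 * M := by ring
  have hf₀δ : IsLipBound r f₀ δ := isLipBound_sub_const hδ c
  have hf₀int : ∫ σ, f₀ σ ∂μ = 0 := by
    rw [hf₀, integral_sub (integrable_of_abs_le' hfm hM) (integrable_const c)]
    simp [hc]
  -- the random-scan operator and the contraction factor
  set P : ((V → S) → ℝ) → (V → S) → ℝ := fun g η => (Fintype.card V : ℝ)⁻¹ * ∑ x, siteAvg γ x g η with hPdef
  have hP : ∀ g η, P g η = (Fintype.card V : ℝ)⁻¹ * ∑ x, siteAvg γ x g η := fun _ _ => rfl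
  set θ : ℝ := 1 - (1 - α) / Fintype.card V with hθ
  have hα0 : 0 ≤ α := (sum_nonneg fun y _ => hC.nonneg _ y).trans (hrow (Classical.arbitrary V))
  have hθ0 : 0 ≤ θ := by
    have hn1 : (1 : ℝ) ≤ Fintype.card V := by exact_mod_cast Fintype.card_pos
    have : (1 - α) / (Fintype.card V : ℝ) ≤ 1 := by rw [div_le_one hn]; linarith
    linarith
  have hit := fun k => measurable_scan_iterate hγ hP hf₀m hf₀M k
  -- the sequence `a k = ⟨P^k f₀, f₀⟩`
  set a : ℕ → ℝ := fun k => ∫ σ, P^[k] f₀ σ * f₀ σ ∂μ with ha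
  -- (i) decay of `a k` from the contraction of the Lipschitz vector
  have hdecay : ∀ k, a k ≤ (R * (∑ y, δ y) * (2 * M)) * θ ^ k := by
    intro k
    obtain ⟨δ', hδ', hsum⟩ := exists_isLipBound_scan_iterate hγ hP hC hrow hf₀m hf₀M hf₀δ k
    set g := P^[k] f₀ with hg
    have hgint : ∫ σ, g σ ∂μ = 0 := by rw [hg, integral_scan_iterate hγ hP hμ hf₀m hf₀M k, hf₀int]
    -- `sup |g| ≤ R θ^k ∑ δ` since `g` has mean zero and oscillation `≤ R ∑ δ'`
    have hgsup : ∀ σ, |g σ| ≤ R * (θ ^ k * ∑ y, δ y) := by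
      intro σ
      have hosc : ∀ τ, |g σ - g τ| ≤ R * ∑ y, δ' y := fun τ =>
        abs_sub_le_mul_sum_of_dependsOn hrR (Δ := univ) (by rw [coe_univ]; exact dependsOn_univ g) hδ' σ τ
      have h1 : g σ = ∫ τ, (g σ - g τ) ∂μ := by
        rw [integral_sub (integrable_const _) (integrable_of_abs_le' (hit k).1 (hit k).2), hgint]
        simp
      rw [h1]
      have h2 := norm_integral_le_of_norm_le_const (μ := μ) (f := fun τ => g σ - g τ)
        (C := R * ∑ y, δ' y) (ae_of_all _ fun τ => by rw [Real.norm_eq_abs]; exact hosc τ)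
      simp only [probReal_univ, mul_one, Real.norm_eq_abs] at h2
      exact h2.trans (mul_le_mul_of_nonneg_left hsum hR)
    have hprod : ∀ σ, |g σ * f₀ σ| ≤ R * (θ ^ k * ∑ y, δ y) * (2 * M) := fun σ => by
      rw [abs_mul]
      exact mul_le_mul (hgsup σ) (hf₀M σ) (abs_nonneg _) ((abs_nonneg _).trans (hgsup σ))
    have h3 := norm_integral_le_of_norm_le_const (μ := μ) (f := fun σ => g σ * f₀ σ)
      (C := R * (θ ^ k * ∑ y, δ y) * (2 * M)) (ae_of_all _ fun σ => by rw [Real.norm_eq_abs]; exact hprod σ)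
    simp only [probReal_univ, mul_one, Real.norm_eq_abs] at h3
    calc a k ≤ |a k| := le_abs_self _
      _ ≤ R * (θ ^ k * ∑ y, δ y) * (2 * M) := h3
      _ = (R * (∑ y, δ y) * (2 * M)) * θ ^ k := by ring
  -- (ii) symmetry: `a (2j) = ‖P^j f₀‖²` and Cauchy–Schwarz `a j ² ≤ a 0 · a (2j)`
  have ha0 : a 0 = ∫ σ, f₀ σ ^ 2 ∂μ := by
    simp only [ha, iterate_zero, id_eq, pow_two]
  have ha0nn : 0 ≤ a 0 := by rw [ha0]; exact integral_nonneg fun σ => sq_nonneg _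
  have hcs : ∀ j, a j ^ 2 ≤ a 0 * a (2 * j) := by
    intro j
    have h2j : a (2 * j) = ∫ σ, P^[j] f₀ σ ^ 2 ∂μ := by
      simp only [ha]
      rw [two_mul, iterate_add_apply,
        integral_scan_iterate_mul_comm hγ hP hC hμ j (hit j).1 hf₀m (hit j).2 hf₀M]
      simp_rw [pow_two]
    rw [h2j, ha0, mul_comm (∫ σ, f₀ σ ^ 2 ∂μ)]
    exact sq_integral_mul_le μ (hit j).1 hf₀m (hit j).2 hf₀M
  -- (iii) `a 1 ≤ θ a 0`
  have hkey : a 1 ≤ θ * a 0 := le_mul_of_sq_chain hθ0 ha0nn hcs hdecay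
  -- (iv) `a 0 - a 1 = (card V)⁻¹ ∑_x ∫ (f₀ - T_x f₀)²`
  have hTint : ∀ x, Integrable (fun σ => siteAvg γ x f₀ σ * f₀ σ) μ := fun x => by
    refine integrable_of_abs_le' ((measurable_siteAvg hγ x hf₀m).mul hf₀m) (M := 2 * M * (2 * M)) fun σ => ?_
    rw [abs_mul]
    exact mul_le_mul (abs_siteAvg_le hγ x hf₀M σ) (hf₀M σ) (abs_nonneg _)
      ((abs_nonneg _).trans (abs_siteAvg_le hγ x hf₀M σ))
  have ha1 : a 1 = (Fintype.card V : ℝ)⁻¹ * ∑ x, ∫ σ, siteAvg γ x f₀ σ ^ 2 ∂μ := by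
    simp only [ha, iterate_one, hPdef]
    simp_rw [mul_assoc, sum_mul]
    rw [integral_const_mul, integral_finsetSum _ fun x _ => hTint x]
    congr 1
    refine sum_congr rfl fun x _ => ?_
    rw [integral_siteAvg_mul_eq hγ hC hμ x hf₀m hf₀m hf₀M hf₀M]
    simp_rw [pow_two]
  have hdir : ∑ x, ∫ σ, (f₀ σ - siteAvg γ x f₀ σ) ^ 2 ∂μ = Fintype.card V * (a 0 - a 1) := by
    simp_rw [integral_sq_sub_siteAvg hγ hC hμ _ hf₀m hf₀M]
    rw [sum_sub_distrib, sum_const, card_univ, nsmul_eq_mul, ha0, ha1, mul_sub, ← mul_assoc,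
      mul_inv_cancel₀ hn.ne', one_mul]
  -- (v) `f₀ - T_x f₀ = f - T_x f`
  have hsame : ∀ x σ, f₀ σ - siteAvg γ x f₀ σ = f σ - siteAvg γ x f σ := fun x σ => by
    simp only [hf₀]
    rw [siteAvg_sub_const hγ x hfm hM c σ]
    ring
  simp_rw [← hsame]
  rw [hdir]
  -- `card V · (a 0 - a 1) ≥ card V · (1 - θ) · a 0 = (1 - α) a 0`
  have h1 : (1 - α) * a 0 = Fintype.card V * ((1 - θ) * a 0) := by
    rw [hθ]; field_simp; ring
  have hgoal : (1 - α) * ∫ σ, (f σ - ∫ τ, f τ ∂μ) ^ 2 ∂μ = (1 - α) * a 0 := by rw [ha0]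
  rw [hgoal, h1]
  exact mul_le_mul_of_nonneg_left (by nlinarith [hkey]) hn.le

/-- **Poincaré inequality for the single-site heat bath, discrete weight** (`r ≡ 1`, Dobrushin's condition in the
total-variation form with row sums `≤ α`): `(1 − α) ∫ (f − μ f)² dμ ≤ ∑_x ∫ (f − T_x f)² dμ` for EVERY bounded
measurable `f`. -/
theorem poincare_of_isKRContraction_one [Nonempty V] [Nonempty S] (hγ : IsSpecification γ)
    (hC : IsKRContraction γ (fun _ _ => (1 : ℝ)) nbr C) {α : ℝ}
    (hrow : ∀ x, ∑ y ∈ nbr x, C x y ≤ α) (hμ : IsGibbsMeasure γ μ) {f : (V → S) → ℝ}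
    (hfm : Measurable f) {M : ℝ} (hM : ∀ σ, |f σ| ≤ M) :
    (1 - α) * ∫ σ, (f σ - ∫ τ, f τ ∂μ) ^ 2 ∂μ ≤ ∑ x, ∫ σ, (f σ - siteAvg γ x f σ) ^ 2 ∂μ :=
  poincare_of_isKRContraction hγ hC (R := 1) (fun _ _ => le_rfl) zero_le_one hrow hμ hfm hM
    (isLipBound_one_of_abs_le hM)

end Poincare

end Summit.QuantumFields.YangMills.Cruxes.IR.ShellMaxCorr.HeatBath

end
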